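import Literature.NumberTheory.EllipticCurves.CanonicalPAdicHeightLocalIndexProofs
import HarnessLib

/-!
# The canonical `p`-adic height: admissible multiples exist
# (discharge of `WeierstrassCurve.exists_admissible_nsmul`)

Trunk T-NT-EC (Literature/NumberTheory/EllipticCurves); fifth proof file behind
`CanonicalPAdicHeight.lean`. It PROVES the named fact `WeierstrassCurve.exists_admissible_nsmul`
stated there (unchanged): for `E/ℚ` with globally minimal `W`, a prime `p` and a non-torsion
`P ∈ E(ℚ)` there is `m ≠ 0` with `mP` ADMISSIBLE — non-torsion, `mP = (x, y)` with `‖x‖_p > 1`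
(`mP ∈ E₁(ℚ_p)`), `z(mP) = -x/y` in the sigma disc `‖z‖_p < p^{-1/(p-1)}`, and non-singular
reduction modulo every prime (`WeierstrassCurve.exists_admissible_nsmul_holds`). With it the `∃!`
forms of the existence theorems of the sibling files (`existsUnique_isCanonical_of_padicSigma_theta`,
`existsUnique_isCanonical_of_theta`, …) lose their hypothesis `hS : exists_admissible_nsmul`.

## The printed argument (Silverman, *AEC*, 2nd ed.) and the assembly

`E(ℚ_ℓ)/E₀(ℚ_ℓ)` is finite (Kodaira–Néron, VII.6.1, Cor. VII.6.2, PDF p. 177; Exercise 7.6,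
PDF p. 181, for the compactness proof), `E₀(ℚ_p)/E₁(ℚ_p) ≅ Ẽ_ns(𝔽_p)` is finite (VII.2.1,
PDF p. 167), and `E₁(ℚ_p) ≅ Ê(pℤ_p)` (VII.2.2, PDF p. 170) is filtered with quotients
`Ê(𝓜ⁿ)/Ê(𝓜ⁿ⁺¹) ≅ 𝔽_p` (IV.3.2(a), PDF p. 116); a point of `E₁(ℚ_p)` reduces to `Õ`, a non-singular
point, and for `p` odd `E₁(ℚ_p)` is already inside the sigma disc, while for `p = 2` the disc is
`Ê(4ℤ₂)`. So with `S` the finite set of primes at which `P` has singular reduction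
(`exists_finset_forall_hasNonsingularReductionAt`),
`m = 2 · [E(ℚ) : E(ℚ) ∩ E₁(ℚ_p)] · ∏_{ℓ ∈ S} [E(ℚ) : E(ℚ) ∩ E₀(ℚ_ℓ)]`
works: the indices are finite and non-zero (`index_kernelOfReductionAt_ne_zero`,
`index_nonsingularReductionSubgroupAt_ne_zero` of `CanonicalPAdicHeightLocalIndexProofs.lean`),
`[E(ℚ) : H] • P ∈ H` (`AddSubgroup.nsmul_index_mem`) and `H` is a subgroup, multiples of a
non-torsion point are non-torsion (`IsOfFinAddOrder.of_nsmul`), the sigma disc is the tree's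
`inSigmaDisc_of_one_lt_norm` for odd `p` and `four_mul_padicNorm_le_padicNorm_addX` +
`inSigmaDisc_two_of_le` (doubling `E₁(ℚ₂) → E₂(ℚ₂)`) for `p = 2`, the last doubling being the
factor `2` of `m`.

## Sources

* J. H. Silverman, *The Arithmetic of Elliptic Curves*, 2nd ed., GTM 106 (2009): VII.2.1
  (PDF p. 167), VII.2.2 (PDF p. 170), VII.6.1, Cor. VII.6.2 (PDF p. 177), Exercise 7.6 (PDF p. 181),
  IV.3.2(a) (PDF p. 116) (held copy `book:silverman2009-arithmetic-elliptic-curves-2nd-ed`).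
  [SilvermanAEC2009]
* B. Mazur, W. Stein, J. Tate, Doc. Math. Extra Vol. Coates (2006), §1 ("replace `P` by a
  multiple"); W. Stein, C. Wuthrich, Math. Comp. 82 (2013), §4.

## Design notes

* Only the assembly; the statement of the fact is untouched (`CanonicalPAdicHeight.lean`). The
  hypothesis `[W.IsGloballyMinimal]` of the fact enters only through `W.IsIntegral ℤ`
  (`IsGloballyMinimal.isIntegral_int`): admissible multiples exist for every `ℤ`-integral
  equation of an elliptic curve (non-singular reduction being taken on that equation).
-/

noncomputable section

open scoped Classical

namespace WeierstrassCurve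

open Literature.NumberTheory.EllipticCurves

/-- **Admissible multiples exist for every `ℤ`-integral equation** of an elliptic curve over `ℚ`:
for a prime `p` and a non-torsion `P ∈ E(ℚ)` there is `m ≠ 0` with `mP` admissible
(`IsAdmissible`: non-torsion, in `E₁(ℚ_p)`, parameter in the sigma disc, non-singular reduction
modulo every prime). `m = 2 · [E(ℚ) : E(ℚ) ∩ E₁(ℚ_p)] · ∏_{ℓ bad for P} [E(ℚ) : E(ℚ) ∩ E₀(ℚ_ℓ)]`.
[Silverman AEC VII.6.1–6.2 (`E/E₀` finite), VII.2.1 (`E₀/E₁ ≅ Ẽ_ns(k)`), VII.2.2, IV.3.2(a);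
Mazur–Stein–Tate 2006, §1] [cite: SilvermanAEC2009, VII.6 Cor. 6.2 (PDF p. 177)] -/
theorem exists_admissible_nsmul_of_isIntegral (W : WeierstrassCurve ℚ) [W.IsElliptic]
    [W.IsIntegral ℤ] (p : ℕ) [Fact p.Prime] (P : W.toAffine.Point) (hP : ¬ IsOfFinAddOrder P) :
    ∃ m : ℕ, m ≠ 0 ∧ W.IsAdmissible p (m • P) := by
  obtain ⟨x, y, h, rfl⟩ := exists_eq_some_of_not_isOfFinAddOrder hP
  -- the finitely many primes at which `P` may have singular reduction
  obtain ⟨S, hS⟩ := exists_finset_forall_hasNonsingularReductionAt h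
  -- the multiplier: the product of the local indices
  set e0 : ℕ → ℕ := fun ℓ =>
    if hℓ : ℓ.Prime then (haveI := Fact.mk hℓ; (W.nonsingularReductionSubgroupAt ℓ).index) else 1
    with he0def
  have he0 : ∀ ℓ, e0 ℓ ≠ 0 := fun ℓ => by
    simp only [he0def]
    split_ifs with hℓ
    · haveI := Fact.mk hℓ; exact W.index_nonsingularReductionSubgroupAt_ne_zero ℓ
    · exact one_ne_zero
  set m₀ := ∏ ℓ ∈ S, e0 ℓ with hm₀
  have hm₀0 : m₀ ≠ 0 := Finset.prod_ne_zero_iff.mpr fun ℓ _ => he0 ℓ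
  have hm₀P : ∀ ℓ : ℕ, (hℓ : ℓ.Prime) → haveI := Fact.mk hℓ;
      m₀ • (Affine.Point.some x y h) ∈ W.nonsingularReductionSubgroupAt ℓ := by
    intro ℓ hℓ
    haveI := Fact.mk hℓ
    by_cases hℓS : ℓ ∈ S
    · obtain ⟨k, hk⟩ : e0 ℓ ∣ m₀ := Finset.dvd_prod_of_mem e0 hℓS
      rw [hk, mul_nsmul (Affine.Point.some x y h)]
      refine AddSubgroup.nsmul_mem _ ?_ k
      have : e0 ℓ = (W.nonsingularReductionSubgroupAt ℓ).index := by simp only [he0def, dif_pos hℓ]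
      rw [this]
      exact AddSubgroup.nsmul_index_mem _ _
    · exact AddSubgroup.nsmul_mem _ ((mem_nonsingularReductionSubgroupAt_iff _).mpr
        ((W.reducesNonsingularlyAt_some ℓ h).mpr (hS ℓ hℓ hℓS))) m₀
  set m₁ := (W.kernelOfReductionAt p).index with hm₁
  have hm₁0 : m₁ ≠ 0 := W.index_kernelOfReductionAt_ne_zero p
  -- `Q = (m₀ m₁) P` lies in `E₁` at `p` and in `E₀` at every prime, and is non-torsion
  have hQ₁ : (m₀ * m₁) • (Affine.Point.some x y h) ∈ W.kernelOfReductionAt p := by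
    rw [mul_comm, mul_nsmul (Affine.Point.some x y h)]
    exact AddSubgroup.nsmul_mem _ (AddSubgroup.nsmul_index_mem _ _) m₀
  have hQ₀ : ∀ ℓ : ℕ, (hℓ : ℓ.Prime) → haveI := Fact.mk hℓ;
      (m₀ * m₁) • (Affine.Point.some x y h) ∈ W.nonsingularReductionSubgroupAt ℓ := by
    intro ℓ hℓ
    haveI := Fact.mk hℓ
    rw [mul_nsmul (Affine.Point.some x y h)]
    exact AddSubgroup.nsmul_mem _ (hm₀P ℓ hℓ) m₁
  have hQfin : ¬ IsOfFinAddOrder ((m₀ * m₁) • (Affine.Point.some x y h)) :=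
    fun hf => hP (hf.of_nsmul (Nat.mul_ne_zero hm₀0 hm₁0))
  obtain ⟨xq, yq, hq, hQeq⟩ := exists_eq_some_of_not_isOfFinAddOrder hQfin
  rw [hQeq] at hQ₁ hQ₀ hQfin
  -- the admissible multiple is `2Q = Q + Q`
  refine ⟨2 * (m₀ * m₁), Nat.mul_ne_zero two_ne_zero (Nat.mul_ne_zero hm₀0 hm₁0), ?_⟩
  rw [mul_nsmul' (Affine.Point.some x y h), hQeq, two_nsmul]
  have hxq : 1 < ‖(xq : ℚ_[p])‖ := (some_mem_kernelOfReductionAt_iff hq).mp hQ₁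
  have hyq : yq ≠ W.toAffine.negY xq yq := fun hneg => hQfin <| by
    refine isOfFinAddOrder_iff_nsmul_eq_zero.mpr ⟨2, two_pos, ?_⟩
    rw [two_nsmul, Affine.Point.add_self_of_Y_eq hneg]
  have hR₁ := add_mem hQ₁ hQ₁
  have hRfin : ¬ IsOfFinAddOrder (Affine.Point.some xq yq hq + Affine.Point.some xq yq hq) := by
    rw [← two_nsmul]; exact fun hf => hQfin (hf.of_nsmul two_ne_zero)
  have hR₀ : ∀ ℓ : ℕ, (hℓ : ℓ.Prime) → haveI := Fact.mk hℓ;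
      Affine.Point.some xq yq hq + Affine.Point.some xq yq hq ∈ W.nonsingularReductionSubgroupAt ℓ :=
    fun ℓ hℓ => by haveI := Fact.mk hℓ; exact add_mem (hQ₀ ℓ hℓ) (hQ₀ ℓ hℓ)
  rw [Affine.Point.add_self_of_Y_ne hyq] at hR₁ hRfin hR₀ ⊢
  have hx₃ := (some_mem_kernelOfReductionAt_iff _).mp hR₁
  refine ⟨hRfin, hx₃, ?_, fun ℓ hℓ => ?_⟩
  · -- the sigma disc
    by_cases hp2 : p = 2
    · subst hp2
      have hxq' : 1 < padicNorm 2 xq := by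
        rw [Padic.eq_padicNorm] at hxq; exact_mod_cast hxq
      have h16 : 16 ≤ padicNorm 2 (W.toAffine.addX xq xq (W.toAffine.slope xq xq yq yq)) := by
        have h4 := four_mul_padicNorm_le_padicNorm_addX hq hxq' hyq
        obtain ⟨-, -, hN4⟩ := padicNorm_Y_of_one_lt 2 hq hxq'
        norm_num at hN4
        linarith
      exact inSigmaDisc_two_of_le (W := W) (Affine.nonsingular_add hq hq fun hxy => hyq hxy.2) h16
    · exact (W.inSigmaDisc_of_one_lt_norm hp2
        (Affine.nonsingular_add hq hq fun hxy => hyq hxy.2) hx₃).2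
  · haveI := Fact.mk hℓ
    exact (W.reducesNonsingularlyAt_some ℓ _).mp
      ((mem_nonsingularReductionSubgroupAt_iff _).mp (hR₀ ℓ hℓ))

/-- **Discharge of `WeierstrassCurve.exists_admissible_nsmul`** (`CanonicalPAdicHeight.lean`): for
`E/ℚ` with globally minimal `W` and any prime `p`, every non-torsion `P ∈ E(ℚ)` has a multiple
`mP`, `m ≠ 0`, which is admissible — `exists_admissible_nsmul_of_isIntegral` for the `ℤ`-integral
equation `W` (`IsGloballyMinimal.isIntegral_int`). [Silverman AEC VII.6.1–6.2, VII.2.1, VII.2.2,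
IV.3.2(a); Mazur–Stein–Tate 2006, §1; Stein–Wuthrich 2013, §4]
[cite: SilvermanAEC2009, VII.6 Cor. 6.2 (PDF p. 177)] -/
theorem exists_admissible_nsmul_holds : exists_admissible_nsmul := by
  intro W _ _ p _ P hP
  exact W.exists_admissible_nsmul_of_isIntegral p P hP

end WeierstrassCurve
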